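import Summits.RiemannHypothesis.RiemannHypothesis.Theorems.AsymptoticCriticalLine.Negative.BandForms
import Literature.NumberTheory.LFunctions.ZeroDensityIngham

/-!
# `AsymptoticCriticalLine` (crux `stmt-RiemannHypothesis-2063`, route `RuelleBand`):
# the known end of the ladder in the counting currency `N(σ, T)` (negative-side support, cycle 2)

Support file of the crux disprover (cdisprove seat refuter-cdisprove-stmt-RiemannHypothesis-2063-g2-0),
companion of `BandForms.lean` and `Ladder.lean`. In the tree's counting function
`N(σ, T) = Literature.NumberTheory.LFunctions.zetaZeroCountRe σ T` (zeros with `Re ρ ≥ σ`,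
`0 < Im ρ ≤ T`, with multiplicity):

* KNOWN (`countRe_isBigO_of_ingham`, one line from Ingham's zero-density estimate PROVED in tree as
  `Literature.NumberTheory.LFunctions.zeroDensity_ingham_holds`): for `0 < ε ≤ 1/2`,
  `N(1/2 + ε, T) = O(T^{1 − 2ε/(3 − 2ε)})` — a power saving, whence every height-sum rung
  `∑_{band} (1 + |γ|)^{−θ} < ∞`, `θ > 1 − 2ε/(3 − 2ε)`, by partial summation;
* THE CRUX (`countRe_bounded_of_acl`): `N(1/2 + ε, T) = O(1)` for every `ε > 0`.

Between a power of `T` and `O(1)` no intermediate rung is known for `ζ`; `Ladder.lean`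
(`not_forall_heightSum_imp_band`) shows that no height-summability statement, of any exponent
`θ > 0`, implies the crux in the abstract.
-/

noncomputable section

namespace Summit.RiemannHypothesis.RiemannHypothesis.Theorems.AsymptoticCriticalLine.Negative

open Complex Set
open Summit.RiemannHypothesis.RiemannHypothesis.Theses.RuelleBand (AsymptoticCriticalLine)

/-! ## 1. The known end of the ladder vs the crux, in the counting currency `N(σ, T)` -/

section known_end

open Literature.NumberTheory.LFunctions (zetaZeroCountRe zetaZeroBox riemannZetaZeroOrder
  riemannZetaZeroOrder_nonneg zeroDensity_ingham_holds)

/-- KNOWN END (Ingham 1940, PROVED in tree as `zeroDensity_ingham_holds`): at level `ε` the band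
zeros up to height `T` number `N(1/2 + ε, T) = O(T^{1 − 2ε/(3 − 2ε)})` — a vanishing proportion
of the `≍ T log T` zeros, but still a POWER of `T`; every height-sum rung
`∑_{band} (1+|γ|)^{−θ} < ∞`, `θ > 1 − 2ε/(3−2ε)`, follows by partial summation. The crux asks
for `O(1)` (`countRe_bounded_of_acl`). [folklore] -/
theorem countRe_isBigO_of_ingham {ε : ℝ} (hε : 0 < ε) (hε' : ε ≤ 1 / 2) :
    (fun T : ℝ => (zetaZeroCountRe (1 / 2 + ε) T : ℝ)) =O[Filter.atTop]
      fun T : ℝ => T ^ (1 - 2 * ε / (3 - 2 * ε)) := by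
  have h3 : 0 < 3 - 2 * ε := by linarith
  have hpos : 0 < 2 * ε / (3 - 2 * ε) := by positivity
  have h : (fun T : ℝ => (zetaZeroCountRe (1 / 2 + ε) T : ℝ)) =O[Filter.atTop]
      fun T : ℝ => T ^ (3 / (2 - (1 / 2 + ε)) * (1 - (1 / 2 + ε)) + 2 * ε / (3 - 2 * ε)) :=
    zeroDensity_ingham_holds (2 * ε / (3 - 2 * ε)) hpos (1 / 2 + ε) (by linarith) (by linarith)
  have he : 3 / (2 - (1 / 2 + ε)) * (1 - (1 / 2 + ε)) + 2 * ε / (3 - 2 * ε) =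
      1 - 2 * ε / (3 - 2 * ε) := by
    have h4 : 2 - (1 / 2 + ε) ≠ 0 := by linarith
    have h5 : 3 - 2 * ε ≠ 0 := h3.ne'
    have hA : 3 / (2 - (1 / 2 + ε)) = 6 / (3 - 2 * ε) := by
      rw [div_eq_div_iff h4 h5]
      ring
    rw [hA, div_mul_eq_mul_div, ← add_div, eq_sub_iff_add_eq, ← add_div, div_eq_iff h5]
    ring
  refine h.congr_right fun T => ?_
  rw [he]

/-- … whereas THE CRUX IS `N(1/2 + ε, T) = O(1)`: under the crux the counting function of every
band is bounded (by the total multiplicity of the finite band). [folklore] -/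
theorem countRe_bounded_of_acl (hacl : AsymptoticCriticalLine) {ε : ℝ} (hε : 0 < ε) :
    ∃ C : ℕ, ∀ T : ℝ, zetaZeroCountRe (1 / 2 + ε) T ≤ C := by
  have hB : (bandSet riemannZeta ε).Finite := hacl ε hε
  refine ⟨(∑ᶠ ρ ∈ bandSet riemannZeta ε, riemannZetaZeroOrder ρ).toNat, fun T => ?_⟩
  have hsub : zetaZeroBox (1 / 2 + ε) T ⊆ bandSet riemannZeta ε := by
    rintro ρ ⟨hz, hσ, h1, _, _⟩
    have hlt : ρ.re < 1 := by
      rcases h1.lt_or_eq with h | h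
      · exact h
      · exact absurd hz (riemannZeta_ne_zero_of_one_le_re h.ge)
    exact ⟨hz, by linarith, hlt, by rw [abs_of_pos (by linarith)]; linarith⟩
  unfold zetaZeroCountRe
  apply Int.toNat_le_toNat
  rw [finsum_mem_eq_finite_toFinset_sum _ (hB.subset hsub), finsum_mem_eq_finite_toFinset_sum _ hB]
  apply Finset.sum_le_sum_of_subset_of_nonneg
  · exact Set.Finite.toFinset_subset_toFinset.2 hsub
  · intro ρ hρ _
    have hρ' : ρ ∈ bandSet riemannZeta ε := hB.mem_toFinset.1 hρ
    refine riemannZetaZeroOrder_nonneg fun h => ?_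
    have := hρ'.2.2.1
    rw [h, Complex.one_re] at this
    exact lt_irrefl _ this

end known_end

end Summit.RiemannHypothesis.RiemannHypothesis.Theorems.AsymptoticCriticalLine.Negative

end
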